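import Literature.Computability.FineGrained.Sweep1EqualityRep
import Mathlib.Analysis.SpecialFunctions.Pow.Real
import Mathlib.Analysis.SpecificLimits.Normed
import HarnessLib

/-!
# Fine-grained complexity, sweep 1: the parameter choice of Williams' Theorem 3

The machine-independent half of the proof of the win-win theorem
`ethr2_lower_bound_or_ov_almost_linear` of `Literature.Computability.FineGrained.Sweep1`
(R. Williams, *The Orthogonal Vectors Conjecture and Non-Uniform Circuit Lower Bounds*, FOCS 2024 /
ECCC TR24-142, proof of Thm. 3, p. 11: "Let `ε' = ε/(2c)`. Choose `k` to be a sufficiently large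
constant, so that by assumption, `DISJ_k` has weak equality rank at most `2^{ε'k}` …", and §4,
proof of Cor. 1, case 1), isolated so that it can be combined with ANY verified implementation of
the counting algorithm:

* `eventually_linear_le_two_rpow`: `2m + 2 ≤ 2^{θ m}` for all large `m` (`θ > 0`);
* `ovAlmostLinear_of_not_eThr2LowerBound_of`: **if** every positive representation
  `R : PosRep k (2^ρ) lam` of `DISJ_k` (`…Sweep1EqualityRep`) with `2ρc ≤ δk` yields a deterministic
  `O(n^{1+δ})` word-RAM algorithm for `OV` in dimension `c log n` (the content of Thms. 8 and 10,
  to be supplied by the machine part), **then** the failure of alternative (1) (`¬ EThr2LowerBound`: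
  for every `ε > 0`, `2^{ε·2m}`-size `ETHR ∘ ETHR` circuits for the read-once 2-DNF exist for all
  large `m`) gives alternative (2) (`OVAlmostLinear`): with `ε = δ/(16c)` pick `k` so large that the
  circuit exists, `2k + 2 ≤ 2^{2εk}` and `12c ≤ δk`; the representation of
  `exists_posRep_of_hasEThr2CircuitOfSize` then has `2^ρ ≤ 2 (2^{2εk} + 2k + 2)² ≤ 2^{3 + 4εk}`
  terms, whence `ρ ≤ 3 + δk/(4c)` and `2ρc ≤ δk`;
* `ethr2_lower_bound_or_ov_almost_linear_of`: the win-win disjunction under the same hypothesis.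

## References

* R. Williams, *The Orthogonal Vectors Conjecture and Non-Uniform Circuit Lower Bounds*,
  FOCS 2024, doi:10.1109/focs61266.2024.00088; ECCC TR24-142 (2024), Thm. 3 (proof, p. 11),
  §4 Cor. 1 (proof, case 1).
-/

namespace Literature.Computability.FineGrained

open Filter Cryptography

namespace EThr2

/-- Eventually `2m + 2 ≤ 2^{θ m}` for `θ > 0`. [folklore] -/
theorem eventually_linear_le_two_rpow {θ : ℝ} (hθ : 0 < θ) :
    ∀ᶠ m : ℕ in atTop, (2 * m + 2 : ℝ) ≤ (2 : ℝ) ^ (θ * m) := by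
  have hr : 1 < (2 : ℝ) ^ θ := Real.one_lt_rpow (by norm_num) hθ
  have h1 := (isLittleO_pow_const_const_pow_of_one_lt (R := ℝ) 1 hr).def (show (0 : ℝ) < 1 / 4 by norm_num)
  have h2 := (tendsto_pow_atTop_atTop_of_one_lt hr).eventually_ge_atTop 4
  filter_upwards [h1, h2] with m hm hm4
  have heq : ((2 : ℝ) ^ θ) ^ m = (2 : ℝ) ^ (θ * m) := by
    rw [← Real.rpow_natCast, ← Real.rpow_mul (by norm_num)]
  rw [← heq]
  simp only [pow_one, Real.norm_natCast, norm_pow, Real.norm_of_nonneg (by positivity : (0:ℝ) ≤ 2 ^ θ)] at hm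
  linarith

/-- **Alternative (2) from the failure of alternative (1), modulo the algorithm** (R. Williams,
ECCC TR24-142, proof of Thm. 3, p. 11, and §4, proof of Cor. 1, case 1): if every positive
representation of `DISJ_k` by `2^ρ` tests with `2ρc ≤ δk` yields a deterministic `O(n^{1+δ})`
algorithm for `OV` in dimension `c log n`, then `¬ EThr2LowerBound` implies `OVAlmostLinear`:
take `ε = δ/(16c)` and `k` so large that the `2^{ε·2k}`-size circuit exists, `2k + 2 ≤ 2^{2εk}` and
`12c ≤ δk`; then `2^ρ ≤ 2 (2^{2εk} + 2k + 2)² ≤ 2^{3+4εk}`, so `ρ ≤ 3 + δk/(4c)` and `2ρc ≤ δk`.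
[cite: WilliamsFOCS2024, Thm. 3 (proof, choice of k), §4 Cor. 1] -/
theorem ovAlmostLinear_of_not_eThr2LowerBound_of
    (halg : ∀ (c : ℕ), 1 ≤ c → ∀ (δ : ℝ), 0 < δ → ∀ (k ρ lam : ℕ), 0 < k →
      ∀ (_R : PosRep k (2 ^ ρ) lam), 2 * (ρ : ℝ) * c ≤ δ * k →
        (OVWithDim c).InTimeO fun n => (n : ℝ) ^ (1 + δ))
    (h : ¬ EThr2LowerBound) : OVAlmostLinear := by
  intro c hc δ hδ
  have hall : ∀ ε : ℝ, 0 < ε → ∀ᶠ m : ℕ in atTop, HasEThr2CircuitOfSize m ((2 : ℝ) ^ (ε * (2 * m))) := by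
    intro ε hε
    by_contra hne
    exact h ⟨ε, hε, Filter.not_eventually.1 hne⟩
  have hcpos : (0 : ℝ) < c := by exact_mod_cast hc
  set ε : ℝ := δ / (16 * c) with hε
  have hεpos : 0 < ε := by positivity
  -- a large block length
  obtain ⟨k, hkcirc, hklin, hk12, hk1⟩ : ∃ k : ℕ, HasEThr2CircuitOfSize k ((2 : ℝ) ^ (ε * (2 * k))) ∧
      (2 * k + 2 : ℝ) ≤ (2 : ℝ) ^ (2 * ε * k) ∧ 12 * (c : ℝ) ≤ δ * k ∧ 1 ≤ k := by
    have e1 := hall ε hεpos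
    have e2 := eventually_linear_le_two_rpow (θ := 2 * ε) (by positivity)
    have e3 : ∀ᶠ k : ℕ in atTop, 12 * (c : ℝ) ≤ δ * k :=
      (tendsto_natCast_atTop_atTop.const_mul_atTop hδ).eventually_ge_atTop _
    have e4 := Filter.eventually_ge_atTop 1
    exact ((e1.and e2).and (e3.and e4)).exists.imp fun k hk => ⟨hk.1.1, hk.1.2, hk.2.1, hk.2.2⟩
  obtain ⟨ρ, lam, hρ, ⟨R⟩⟩ := exists_posRep_of_hasEThr2CircuitOfSize hkcirc
  -- `2 ρ c ≤ δ k`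
  have hpar : 2 * (ρ : ℝ) * c ≤ δ * k := by
    set s : ℝ := (2 : ℝ) ^ (2 * ε * k) with hs
    have hs' : (2 : ℝ) ^ (ε * (2 * k)) = s := by rw [hs]; ring_nf
    rw [hs'] at hρ
    have hk0 : (0 : ℝ) ≤ k := Nat.cast_nonneg _
    have hspos : 0 < s := by positivity
    -- `2^ρ ≤ 2 (s + 2k + 2)² ≤ 8 s² = 2^(3 + 4 ε k)`
    have h1 : (2 : ℝ) ^ ρ ≤ 8 * s ^ 2 := by nlinarith
    have h2 : (8 : ℝ) * s ^ 2 = (2 : ℝ) ^ ((3 : ℝ) + 4 * ε * k) := by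
      rw [Real.rpow_add (by norm_num), show (4 : ℝ) * ε * k = (2 * ε * k) * 2 by ring,
        Real.rpow_mul (by norm_num), hs]
      norm_num
    have h3 : ((ρ : ℕ) : ℝ) ≤ 3 + 4 * ε * k := by
      rw [← Real.rpow_le_rpow_left_iff one_lt_two, Real.rpow_natCast, ← h2]; exact h1
    have h4 : 4 * ε * k = δ * k / (4 * c) := by rw [hε]; field_simp; ring
    rw [h4] at h3
    -- `2 ρ c ≤ 6 c + δ k / 2 ≤ δ k`
    have h5 : 2 * (ρ : ℝ) * c ≤ 6 * c + δ * k / 2 := by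
      have := mul_le_mul_of_nonneg_right h3 (show (0:ℝ) ≤ 2 * c by positivity)
      have h6 : (3 + δ * ↑k / (4 * ↑c)) * (2 * ↑c) = 6 * c + δ * k / 2 := by field_simp; ring
      nlinarith [h6]
    linarith
  exact halg c hc δ hδ k ρ lam (by omega) R hpar


/-- **The win-win disjunction from an implementation of the counting algorithm** (R. Williams,
ECCC TR24-142, abstract / Cor. 1): either alternative (1) holds, or — given the algorithmic content
of Thms. 8 and 10 for positive representations — alternative (2). [cite: WilliamsFOCS2024, abstract, §4 Cor. 1] -/
theorem ethr2_lower_bound_or_ov_almost_linear_of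
    (halg : ∀ (c : ℕ), 1 ≤ c → ∀ (δ : ℝ), 0 < δ → ∀ (k ρ lam : ℕ), 0 < k →
      ∀ (_R : PosRep k (2 ^ ρ) lam), 2 * (ρ : ℝ) * c ≤ δ * k →
        (OVWithDim c).InTimeO fun n => (n : ℝ) ^ (1 + δ)) :
    ethr2_lower_bound_or_ov_almost_linear := by
  by_cases h : EThr2LowerBound
  · exact Or.inl h
  · exact Or.inr (ovAlmostLinear_of_not_eThr2LowerBound_of halg h)

end EThr2

end Literature.Computability.FineGrained
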